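import Summits.CriticalPhenomena.PercolationContinuityZ3.Theorems.SahiMasterFamilyBottomRecursion

/-!
# Divisibility of `E_k` at the rare corner: zero-flag `0`-minors kill the lower square-free coefficients

Unit `prim-master-conj` (crux anchor stmt-CriticalPhenomena-4575), gen 8; paper BOTTOM-COEFFICIENT.md §2.1, §7.2.  For a family `U` of events:

* `sahiEPoly_eq_zero_of_suppZeroFlag` — a zero flag has ZERO polynomial `E_k` (grid form of the Nullstellensatz);
* `sahiE_weight_eq_secAt_of_apply_eq_zero` — at a parameter with `x_e = 0` the functional only sees the `0`-sections `secAt e false ∘ U`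
  (push-forward along `forceAt e false`, any real parameters);
* `coeff_sahiEPoly_eq_zero_of_secAt_suppZeroFlag` — **if the `0`-minor at `e` is a zero flag then every coefficient `[X^m] E_k(U)` with
  `m e = 0` vanishes**; in particular (`coeff_blockProfile_sahiEPoly_eq_zero_of_forall_secAt`) if ALL `0`-minors are zero flags then every
  square-free coefficient `[X^A] E_k(U)`, `A ≠ univ`, vanishes — `∏_e X_e` divides the square-free part and the bottom coefficient is the
  rare-corner leading term;
* `bottomCoeff_peel_of_uniform` — combining with `bottomCoeff_peel`: if slot `i` peels every `0`-minor in the sense that the deleted family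
  `U_{−i}` has all its `0`-minors in `Z_{k−1}` (the half of "uniform peeling slot" that the recursion needs) and `∅ ∉ U_i`, then
  `[∏X_e] E_k(U) = Σ_l [∏X_e] E_{k−1}(U_{−i}[l ↦ U_l ∩ U_i])`.
Pure algebra over the tree's `sahiEPoly`; axioms standard. [this work]
-/

noncomputable section

open scoped Classical

namespace Summit.CriticalPhenomena.PercolationContinuityZ3.Theorems

open Finset Function MvPolynomial
open Literature.Computability.AlgebraicComplexity (blockProfile blockProfile_apply blockProfile_injective)
open Literature.Combinatorics.Sahi2008
open Literature.Probability.Percolation.BHK2006 (weight)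
open Literature.Probability.Percolation.DecisionTree (ind ind_of_mem ind_of_not_mem)

variable {ι : Type} [Fintype ι]

/-! ### Zero flags have zero polynomial -/

/-- **A zero flag has `E_k ≡ 0` as a polynomial.** [this work] -/
theorem sahiEPoly_eq_zero_of_suppZeroFlag {k : ℕ} {U : Fin k → Set (Set ι)} (hU : SuppZeroFlag k U) :
    sahiEPoly k (fun j => ind (U j)) = 0 := by
  refine eq_zero_of_eval_zero_at_prod_finset _ (fun _ => gridPts k)
    (fun e => (degreeOf_sahiEPoly_le e k _).trans_lt (by rw [card_gridPts]; omega)) fun x hx => ?_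
  have hx01 : ∀ e, x e ∈ Set.Ioo (0 : ℝ) 1 := fun e => mem_Ioo_of_mem_gridPts (hx e)
  rw [eval_sahiEPoly]
  exact sahiE_ind_eq_zero_of_suppZeroFlag (fun e => ⟨x e, (hx01 e).1.le, (hx01 e).2.le⟩) hU

/-! ### At `x_e = 0` the functional sees only the `0`-sections -/

/-- The product weight vanishes on configurations containing a coordinate with parameter `0`. [folklore] -/
theorem weight_eq_zero_of_mem {x : ι → ℝ} {e : ι} (hxe : x e = 0) {ω : Set ι} (he : e ∈ ω) : weight x ω = 0 := by
  unfold weight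
  exact Finset.prod_eq_zero (Finset.mem_univ e) (by rw [if_pos he, hxe])

/-- At a parameter with `x_e = 0`, expectations only see `h ∘ forceAt e false`. [this work] -/
theorem ex_weight_eq_comp_forceAt {x : ι → ℝ} {e : ι} (hxe : x e = 0) (h : Set ι → ℝ) :
    ex (weight x) h = ex (weight x) (h ∘ forceAt e false) := by
  unfold ex
  refine Finset.sum_congr rfl fun ω _ => ?_
  by_cases he : e ∈ ω
  · rw [weight_eq_zero_of_mem hxe he, zero_mul, zero_mul]
  · simp only [Function.comp_apply, forceAt, cond_false, Set.sdiff_singleton_eq_self he]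

/-- **At `x_e = 0`, `E_k` of a family of events is `E_k` of its `0`-sections**, for arbitrary real parameters. [this work] -/
theorem sahiE_weight_eq_secAt_of_apply_eq_zero {x : ι → ℝ} {e : ι} (hxe : x e = 0) {k : ℕ} (U : Fin k → Set (Set ι)) :
    sahiE (weight x) k (fun j => ind (U j)) = sahiE (weight x) k (fun j => ind (secAt e false (U j))) := by
  rw [Literature.Probability.Percolation.BHK2006.sahiE_eq_of_ex_eq (weight x) (weight x) (forceAt e false)
    (ex_weight_eq_comp_forceAt hxe) k]
  simp only [ind_secAt_eq_comp]

/-! ### Killing the coefficients not involving `X_e` -/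

omit [Fintype ι] in
/-- The monomials of `P` not involving `X_e`, as a polynomial. [this work] -/
theorem coeff_sum_filter_monomial (P : MvPolynomial ι ℝ) (e : ι) (m : ι →₀ ℕ) :
    coeff m (∑ d ∈ P.support.filter (fun d => d e = 0), monomial d (coeff d P)) = if m e = 0 then coeff m P else 0 := by
  rw [coeff_sum]
  simp only [coeff_monomial, Finset.sum_ite_eq', Finset.mem_filter, mem_support_iff, ne_eq]
  by_cases hm : m e = 0
  · by_cases hc : coeff m P = 0
    · simp [hm, hc]
    · simp [hm, hc]
  · simp [hm]

/-- Evaluation of a sum of monomials. [folklore] -/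
theorem eval_sum_monomial (x : ι → ℝ) (T : Finset (ι →₀ ℕ)) (c : (ι →₀ ℕ) → ℝ) :
    eval x (∑ d ∈ T, monomial d (c d)) = ∑ d ∈ T, c d * ∏ i, x i ^ d i := by
  rw [map_sum]
  refine Finset.sum_congr rfl fun d _ => ?_
  rw [eval_monomial, Finsupp.prod_fintype]
  intro i; exact pow_zero _

/-- **If the `0`-minor at `e` is a zero flag, every coefficient of `E_k(U)` not involving `X_e` vanishes.** [this work] -/
theorem coeff_sahiEPoly_eq_zero_of_secAt_suppZeroFlag {k : ℕ} (U : Fin k → Set (Set ι)) (e : ι)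
    (h0 : SuppZeroFlag k (fun j => secAt e false (U j))) {m : ι →₀ ℕ} (hm : m e = 0) :
    coeff m (sahiEPoly k fun j => ind (U j)) = 0 := by
  set P : MvPolynomial ι ℝ := sahiEPoly k fun j => ind (U j) with hP
  -- the part of `P` not involving `X_e`
  set P₀ : MvPolynomial ι ℝ := ∑ d ∈ P.support.filter (fun d => d e = 0), monomial d (coeff d P) with hP₀
  -- `P₀` vanishes identically: at every `x` it equals `P` evaluated at `x` with `x_e := 0`, i.e. `E_k` of the `0`-sections, i.e. `0`
  have hzero : P₀ = 0 := by
    apply MvPolynomial.funext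
    intro x
    rw [map_zero]
    set x' : ι → ℝ := update x e 0 with hx'
    have hx'e : x' e = 0 := by simp [hx']
    -- `eval x P₀ = eval x' P₀` (no `X_e` in `P₀`)
    have h1 : eval x P₀ = eval x' P₀ := by
      rw [hP₀, eval_sum_monomial, eval_sum_monomial]
      refine Finset.sum_congr rfl fun d hd => ?_
      have hde : d e = 0 := (Finset.mem_filter.1 hd).2
      congr 1
      refine Finset.prod_congr rfl fun i _ => ?_
      by_cases hie : i = e
      · subst hie; rw [hde, pow_zero, pow_zero]
      · rw [hx', update_of_ne hie]
    -- `eval x' P₀ = eval x' P` (the other monomials contain `X_e` and `x'_e = 0`)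
    have h2 : eval x' P₀ = eval x' P := by
      rw [hP₀, eval_sum_monomial, MvPolynomial.eval_eq' x' P, ← Finset.sum_filter_add_sum_filter_not P.support (fun d => d e = 0)]
      rw [left_eq_add]
      refine Finset.sum_eq_zero fun d hd => ?_
      have hde : d e ≠ 0 := (Finset.mem_filter.1 hd).2
      rw [Finset.prod_eq_zero (Finset.mem_univ e) (by rw [hx'e, zero_pow hde]), mul_zero]
    -- `eval x' P = E_k` of the `0`-sections `= 0`
    have h3 : eval x' P = 0 := by
      rw [hP, eval_sahiEPoly, sahiE_weight_eq_secAt_of_apply_eq_zero hx'e U, ← eval_sahiEPoly,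
        sahiEPoly_eq_zero_of_suppZeroFlag h0, map_zero]
    rw [h1, h2, h3]
  have := coeff_sum_filter_monomial P e m
  rw [← hP₀, hzero, coeff_zero, if_pos hm] at this
  exact this.symm

/-- **All `0`-minors zero flags ⇒ all square-free coefficients below the top vanish** (`∏_e X_e` divides the square-free part of `E_k(U)`).
[this work] -/
theorem coeff_blockProfile_sahiEPoly_eq_zero_of_forall_secAt {k : ℕ} (U : Fin k → Set (Set ι))
    (h0 : ∀ e, SuppZeroFlag k (fun j => secAt e false (U j))) {A : Finset ι} (hA : A ≠ univ) :
    coeff (blockProfile A) (sahiEPoly k fun j => ind (U j)) = 0 := by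
  obtain ⟨e, -, heA⟩ := Finset.exists_of_ssubset (Finset.ssubset_iff_subset_ne.2 ⟨Finset.subset_univ A, hA⟩)
  exact coeff_sahiEPoly_eq_zero_of_secAt_suppZeroFlag U e (h0 e) (by rw [blockProfile_apply, if_neg heA])

/-- **The bottom-coefficient recursion at a peeling slot of all `0`-minors.**  If `∅ ∉ U_i` and every `0`-minor of the deleted family `U_{−i}`
is a zero flag of order `n + 1` (this is half of "`i` is a uniform peeling slot"; paper §7.2), then
`[∏_e X_e] E_{n+2}(U) = Σ_l [∏_e X_e] E_{n+1}(U_{−i}[l ↦ U_l ∩ U_i])`. [this work] -/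
theorem bottomCoeff_peel_of_uniform {n : ℕ} (U : Fin (n + 2) → Set (Set ι)) (i : Fin (n + 2)) (hUi : ∅ ∉ U i)
    (h0 : ∀ e, SuppZeroFlag (n + 1) (fun j => secAt e false (U (i.succAbove j)))) :
    coeff (blockProfile (univ : Finset ι)) (sahiEPoly (n + 2) fun j => ind (U j)) =
      ∑ l : Fin (n + 1), coeff (blockProfile (univ : Finset ι))
        (sahiEPoly (n + 1) fun j => ind (update (fun j => U (i.succAbove j)) l (U (i.succAbove l) ∩ U i) j)) :=
  bottomCoeff_peel U i hUi fun _ hA => coeff_blockProfile_sahiEPoly_eq_zero_of_forall_secAt _ h0 hA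

end Summit.CriticalPhenomena.PercolationContinuityZ3.Theorems
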